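import Literature.Geometry.Kaehler.ComplexTorusAntisymplecticGraphQuotient
import Literature.Geometry.Kaehler.ComplexTorusComplementaryExponentsProduct
import Literature.Geometry.Kaehler.ComplexTorusPolarizedDecomposition
import HarnessLib

/-!
# Debarre's construction, II: `(Y × Z)/graph(p)` contains `(Y, θ_Y)` and `(Z, θ_Z)` as complementary abelian
subvarieties (Iribar López 2024, Lemma 10, second assertion)

Layer `Literature/Geometry/Kaehler`, namespace `Literature.Geometry.Kaehler.ComplexTorus`; lane `lit-hodgefound`
(Track 2 foundations library, Layer A4, row A4-76, seat `lit-hodgefound-skel-4`, FILE B of the row).  Sequel of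
`ComplexTorusAntisymplecticGraphQuotient.lean` (FILE A: `graphSubgroup K₁ K₂ p`, `IsAntisymplectic`, the quotient
`(Y × Z)/graph(p) = quotientByPeriod (prodPeriod Φ₁ Φ₂) (graphSubgroup …)` is principally polarised by the descended
`p₁^*ω₁ + p₂^*ω₂`, `graphSubgroup_inf_subtorus_fst/sndSubspace`: the graph meets the factors trivially), of
`ComplexTorusComplementaryExponentsProduct.lean` (`isSubPolarizationType_fst/sndSubspace_iff`: the induced types on
the factors of a product) and `ComplexTorusComplementaryTypes.lean` (`IsSubPolarizationType`, Cor. 5.3.5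
`IsPrincipalPolarization.isSubPolarizationType_compl`).

Sources followed.  A. Iribar López, *Noether–Lefschetz cycles on the moduli space of abelian varieties*, Forum
Math. Pi (2026), held text `paper:arxiv-2411.09910`, §2.2 p. 7 L104–L137, VERBATIM:

> "If `δ = (d₁, …, d_u)` is a polarization type with `u ≤ g/2`, its complementary type is
> `δ̃ = (1, …, 1, d₁, …, d_u)` (`g − 2u` ones) […] If `(X, θ)` is a principally polarized abelian variety of
> dimension `g` and `Y` is a `u`-dimensional abelian subvariety, then `Z := …` is the complementary subvariety
> of `Y`. It has dimension `g − u` and by [BL04], if `θ|_Y` is of type `(d₁, …, d_u)` then `θ|_Z` is of type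
> `δ̃`. […] **Lemma 10.** With notation as above, for any antisymplectic isomorphism `p : K(θ_Y) → K(θ_Z)`,
> the abelian variety `(Y × Z)/graph(p)` has a canonical principal polarization `θ_p` and contains `(Y, θ_Y)`,
> `(Z, θ_Z)` as complementary subvarieties."

R. Auffarth, Math. Z. 282 (2016), held text `paper:arxiv-1507.08618`, proof of Lemma 3.7, p. 10 L40, VERBATIM:
"Moreover, `H ∩ {0} × Y = H ∩ X × {0} = {(0,0)}`" — so the projection `π : X × Y → (X × Y)/H` restricts to
isomorphisms of the factors onto their images.  H. Lange, *Abelian Varieties over the Complex Numbers* (2023),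
§1.1.2 Prop. 1.1.10 (a) (p. 20: "Im f is a complex subtorus of `X'`"), §1.5.1 (p. 51: the type is determined
by `(Λ, E)`), §5.3.1 Cor. 5.3.5 (p. 263).

## Lean rendering

`π : X → X/Γ` (`quotientByPeriod Φ Γ`, rational representation `A = quotientMatrix Φ Γ`, analytic
representation `id_E`) sends the sub-torus `Y = π_X(U)` of `X` (`U ⊆ ℝ^ι` a lattice subspace, `Φ(U)` complex)
to the sub-torus of `X/Γ` with lattice coordinates `A_ℝ(U) = U.map (Matrix.toLin' A_ℝ)` and the SAME tangent
space `Φ(U)` (§1); when `Γ ∩ Y = 0` the lattice of `π(Y)` is `A(Λ ∩ U)` (`subLatticeQuotientEquiv`), so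
`π|_Y : (Y, ι_Y^*L) → (π(Y), ι^*M)` is an isomorphism of polarised tori and the TYPES agree
(`isSubPolarizationType_map_quotientMatrix_iff`, §2).  (For a GENERAL homomorphism with `ℂ`-linear analytic
representation the image sub-torus is treated in `ComplexTorusSubvarietyExponentIsogeny.lean` §1 with the
`mulVecLin` spelling — `isLatticeSubspace_map`, `isComplexSubspace_map`, `map_subtorus`; the lemmas here are the
`quotientByPeriod`/`Matrix.toLin'` specialisations matching the `map_toLin'` vocabulary of
`ComplexTorusPolarizedDecomposition.lean`, plus the lattice comparison `Γ ∩ Y = 0 ⇒ Λ_Γ ∩ A_ℝ U = A(Λ ∩ U)`, which is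
specific to quotients.)  §3 applies this to `X = Y × Z`, `Γ = graph(p)`,
`U = fstSubspace` / `sndSubspace` (`Y × 0`, `0 × Z`), which meet `graph(p)` trivially (FILE A).

## Main statements (all proved; ONE small definition with body `subLatticeQuotientEquiv`; no named fact,
net debt 0)

* §1 `quotientByPeriod_toLin'_apply`, `quotientByPeriod_symm_apply`, `mulVec_quotientMatrix_injective`,
  `mem_map_toLin'_quotientMatrix_iff`, **`isLatticeSubspace_map_quotientMatrix`**,
  **`isComplexSubspace_map_quotientMatrix`** (Prop. 1.1.10 (a) for `π`), `finrank_map_quotientMatrix`,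
  `twoForm_quotientByPeriod_toLin'`, **`orthSubspace_map_quotientMatrix`** (`(A_ℝ U)^⊥ = A_ℝ(U^⊥)`),
  **`subtorus_map_quotientMatrix`** (`π(π_X(U))` is the sub-torus of `A_ℝ(U)`), `quotientMatrix_mulVec_mem_subLattice_map`,
  **`exists_quotientMatrix_mulVec_eq_of_mem_subLattice_map`** (`Γ ∩ Y = 0 ⇒ Λ_Γ ∩ A_ℝ(U) = A(Λ ∩ U)`), `subLatticeQuotientEquiv`;
* §2 **`isSubPolarizationType_iff_of_subLatticeEquiv`** (the type is an invariant of `(Λ_Y, E|Λ_Y)`),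
  **`isSubPolarizationType_map_quotientMatrix_iff`**;
* §3 for `X_p = (Y × Z)/graph(p)`, `Y' = A_ℝ(Y × 0)`, `Z' = A_ℝ(0 × Z)`: lattice / complex subspaces, `dim`,
  `subtorus_fst/sndSubspace_map_graph` (`Y' = π(Y × 0)`, `Z' = π(0 × Z)`),
  **`isSubPolarizationType_fstSubspace_map_graph_iff`** (type of `Y'` = type of `ω₁`, `p` injective),
  **`isSubPolarizationType_sndSubspace_map_graph_iff`**, **`orthSubspace_fstSubspace_map_graph`** (`(Y')^⊥ = Z'`),
  `orthSubspace_sndSubspace` (the product: `(0 × X₂)^⊥ = X₁ × 0`), `orthSubspace_sndSubspace_map_graph`,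
  `finrank_sndSubspace`;
* §4 **`isPrincipalPolarization_and_complementary_pair_quotientBy_graphSubgroup`** — LEMMA 10 (first and second
  assertions together) for Riemann forms and an antisymplectic bijection `p : K(L₁) → K(L₂)`;
* §5 **`IsAntisymplectic.polarizationType_eq_one_and_eq`** (`'`): Cor. 5.3.5 read on `(Y', Z')` — an
  antisymplectic `K(L₁) ≅ K(L₂)` between polarised tori of types `δ` (length `u`) and `δ'` (length `v ≥ u`)
  forces `δ' = (1, …, 1, δ)` (Iribar López's complementary type `δ̃`).

NOT here (FILE C): the Siegel-space reading (`NL_{g,δ}` / `𝒫_{g,δ}`), "does not depend on `p`", "all … arise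
this way", existence of antisymplectic isomorphisms for prescribed types.

## References

* [IribarLopez2024NoetherLefschetzCycles] A. Iribar López, *Noether–Lefschetz cycles on the moduli space of abelian
  varieties*, Forum Math. Pi (2026), arXiv:2411.09910, §2.2 (p. 7), Lemma 10.
* [Auffarth2016NonSimplePPAV] R. Auffarth, Math. Z. 282 (2016) 731–746, arXiv:1507.08618, §3, Lemma 3.7 (p. 10).
* [Debarre1988ThetaSingulierCodim3] O. Debarre, Duke Math. J. 57 (1988) 221–273 (original construction; via the
  two sources above).
* [Lange2023AbelianVarietiesComplex] H. Lange, *Abelian Varieties over the Complex Numbers* (2023), §1.1.2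
  Prop. 1.1.10, Prop. 1.1.13, Lemma 1.1.11 (pp. 20–21), §1.5.1 (p. 51), §2.4.4 Cor. 2.4.24 (p. 123), §2.7.1
  Prop. 2.7.2 (p. 149), §5.3.1 Cor. 5.3.5 (pp. 262–263).
-/

noncomputable section

open Complex Module Function Matrix Submodule

namespace Literature.Geometry.Kaehler

namespace ComplexTorus

/-! ### §1 Abelian subvarieties descend along `π : X → X/Γ` (the image `π(Y)` of a sub-torus) -/

section Descend

variable {ι : Type*} [Fintype ι] [DecidableEq ι] {E : Type*} [NormedAddCommGroup E] [NormedSpace ℂ E]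
  (Φ : (ι → ℝ) ≃L[ℝ] E) (Γ : AddSubgroup (ComplexTorus Φ)) [Finite Γ]

/-- `Φ_Γ (A_ℝ x) = Φ x` for `Φ_Γ = quotientByPeriod Φ Γ` and `A = quotientMatrix Φ Γ = ρ_r(π)`: the analytic
representation of `π : X → X/Γ` is the identity. [cite: Lange2023AbelianVarietiesComplex, §1.1.2 ("the natural projection `p : X → X/Γ`", p. 21)] -/
theorem quotientByPeriod_toLin'_apply (x : ι → ℝ) :
    quotientByPeriod Φ Γ (Matrix.toLin' ((quotientMatrix Φ Γ).map (Int.cast : ℤ → ℝ)) x) = Φ x := by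
  rw [Matrix.toLin'_apply]
  exact quotientPeriod_mulVec Φ _ _ x

/-- `Φ_Γ⁻¹ = A_ℝ ∘ Φ⁻¹`. [cite: Lange2023AbelianVarietiesComplex, §1.1.2 ("`X/Γ = V/π⁻¹(Γ)`", p. 21)] -/
theorem quotientByPeriod_symm_apply (e : E) :
    (quotientByPeriod Φ Γ).symm e = ((quotientMatrix Φ Γ).map (Int.cast : ℤ → ℝ)) *ᵥ (Φ.symm e) := by
  apply (quotientByPeriod Φ Γ).injective
  rw [ContinuousLinearEquiv.apply_symm_apply, quotientPeriod_mulVec, ContinuousLinearEquiv.apply_symm_apply]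

/-- `A_ℝ` is injective (`det A ≠ 0`). [cite: Lange2023AbelianVarietiesComplex, §1.1.2 Lemma 1.1.11, p. 21] -/
theorem mulVec_quotientMatrix_injective :
    Injective fun x : ι → ℝ ↦ ((quotientMatrix Φ Γ).map (Int.cast : ℤ → ℝ)) *ᵥ x := by
  intro x y h
  have h' := congrArg (quotientByPeriod Φ Γ) h
  simp only [quotientPeriod_mulVec] at h'
  exact Φ.injective h'

variable (U : Submodule ℝ (ι → ℝ))

/-- **`x ∈ A_ℝ(U) ↔ Φ⁻¹(Φ_Γ x) ∈ U`**: the sub-torus `π(Y)` of `X/Γ = E/π⁻¹(Γ)` has the SAME complex tangent space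
`Φ(U) ⊆ E` as `Y = π_X(U)`; in the lattice coordinates of `X/Γ` it is `A_ℝ(U)`.
[cite: Lange2023AbelianVarietiesComplex, §1.1.2 Prop. 1.1.10 (a) ("Im f is a complex subtorus"), p. 20] -/
theorem mem_map_toLin'_quotientMatrix_iff {x : ι → ℝ} :
    x ∈ U.map (Matrix.toLin' ((quotientMatrix Φ Γ).map (Int.cast : ℤ → ℝ))) ↔
      Φ.symm (quotientByPeriod Φ Γ x) ∈ U := by
  constructor
  · rintro ⟨y, hy, rfl⟩
    rwa [quotientByPeriod_toLin'_apply, ContinuousLinearEquiv.symm_apply_apply]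
  · intro hx
    refine ⟨Φ.symm (quotientByPeriod Φ Γ x), hx, ?_⟩
    rw [Matrix.toLin'_apply, ← quotientByPeriod_symm_apply, ContinuousLinearEquiv.symm_apply_apply]

/-- `A_ℝ(U)` is a lattice subspace of `X/Γ` if `U` is one of `X` (`A` is an integer matrix).
[cite: Lange2023AbelianVarietiesComplex, §1.1.2 Prop. 1.1.10 (a), p. 20] -/
theorem isLatticeSubspace_map_quotientMatrix (hU : IsLatticeSubspace U) :
    IsLatticeSubspace (U.map (Matrix.toLin' ((quotientMatrix Φ Γ).map (Int.cast : ℤ → ℝ)))) :=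
  hU.map_toLin' _

/-- **`π(Y)` is a complex sub-torus of `X/Γ`**: `A_ℝ(U)` is a complex subspace for `Φ_Γ` if `U` is one for
`Φ` (both have tangent space `Φ(U)`). [cite: Lange2023AbelianVarietiesComplex, §1.1.2 Prop. 1.1.10 (a), p. 20] -/
theorem isComplexSubspace_map_quotientMatrix (hU : IsComplexSubspace Φ U) :
    IsComplexSubspace (quotientByPeriod Φ Γ) (U.map (Matrix.toLin' ((quotientMatrix Φ Γ).map (Int.cast : ℤ → ℝ)))) := by
  intro x hx
  rw [mem_map_toLin'_quotientMatrix_iff] at hx ⊢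
  rw [ContinuousLinearEquiv.apply_symm_apply, ← Φ.apply_symm_apply (quotientByPeriod Φ Γ x)]
  exact hU _ hx

/-- `dim_ℝ A_ℝ(U) = dim_ℝ U` (`π(Y)` has the dimension of `Y`). [cite: Lange2023AbelianVarietiesComplex, §1.1.2 Prop. 1.1.10 (a), p. 20] -/
theorem finrank_map_quotientMatrix :
    finrank ℝ (U.map (Matrix.toLin' ((quotientMatrix Φ Γ).map (Int.cast : ℤ → ℝ)))) = finrank ℝ U := by
  refine LinearEquiv.finrank_eq (Submodule.equivMapOfInjective _ ?_ U).symm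
  intro x y h
  exact mulVec_quotientMatrix_injective Φ Γ (by simpa only [Matrix.toLin'_apply] using h)

/-- The descended form takes the same values: `η(Φ_Γ(A_ℝ x), Φ_Γ(A_ℝ y)) = η(Φ x, Φ y)`.
[cite: Lange2023AbelianVarietiesComplex, §2.7.1 Prop. 2.7.2 (`L = π^*M`), p. 149] -/
theorem twoForm_quotientByPeriod_toLin' (η : E [⋀^Fin 2]→L[ℝ] ℝ) (x y : ι → ℝ) :
    η ![quotientByPeriod Φ Γ (Matrix.toLin' ((quotientMatrix Φ Γ).map (Int.cast : ℤ → ℝ)) x),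
        quotientByPeriod Φ Γ (Matrix.toLin' ((quotientMatrix Φ Γ).map (Int.cast : ℤ → ℝ)) y)] =
      η ![Φ x, Φ y] := by
  rw [quotientByPeriod_toLin'_apply, quotientByPeriod_toLin'_apply]

/-- **Orthogonal complements descend: `(A_ℝ U)^⊥ = A_ℝ(U^⊥)`** for the descended form on `X/Γ` (the
complementary sub-torus of `π(Y)` is `π(Z)`, `Z = Y^⊥`). [cite: Lange2023AbelianVarietiesComplex, §5.3.1 (complementary abelian subvarieties), p. 262] [cite: IribarLopez2024NoetherLefschetzCycles, §2.2 Lemma 10 ("as complementary subvarieties")] -/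
theorem orthSubspace_map_quotientMatrix (η : E [⋀^Fin 2]→L[ℝ] ℝ) :
    orthSubspace (quotientByPeriod Φ Γ) η (U.map (Matrix.toLin' ((quotientMatrix Φ Γ).map (Int.cast : ℤ → ℝ)))) =
      (orthSubspace Φ η U).map (Matrix.toLin' ((quotientMatrix Φ Γ).map (Int.cast : ℤ → ℝ))) := by
  ext x
  rw [mem_orthSubspace_iff, mem_map_toLin'_quotientMatrix_iff, mem_orthSubspace_iff]
  constructor
  · intro h n hn
    have h1 := h _ ⟨n, hn, rfl⟩
    rwa [quotientByPeriod_toLin'_apply, ← Φ.apply_symm_apply (quotientByPeriod Φ Γ x)] at h1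
  · rintro h _ ⟨n, hn, rfl⟩
    have h1 := h n hn
    rw [ContinuousLinearEquiv.apply_symm_apply] at h1
    rwa [quotientByPeriod_toLin'_apply]

/-- **`π(Y) = π(π_X(U))` is the sub-torus of `A_ℝ(U)`**: the image of the sub-torus `Y ⊂ X` under
`π : X → X/Γ` is the sub-torus of `X/Γ` with lattice coordinates `A_ℝ(U)` (`π(π_X x) = π_{X/Γ}(A_ℝ x)`).
[cite: Lange2023AbelianVarietiesComplex, §1.1.2 Prop. 1.1.10 (a), p. 20] [cite: IribarLopez2024NoetherLefschetzCycles, §2.2 Lemma 10] -/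
theorem subtorus_map_quotientMatrix :
    subtorus (quotientByPeriod Φ Γ) (U.map (Matrix.toLin' ((quotientMatrix Φ Γ).map (Int.cast : ℤ → ℝ)))) =
      (subtorus Φ U).map (mapMatrixHom Φ (quotientByPeriod Φ Γ) (quotientMatrix Φ Γ)) := by
  ext t
  rw [mem_subtorus_iff, AddSubgroup.mem_map]
  constructor
  · rintro ⟨_, ⟨x, hx, rfl⟩, rfl⟩
    refine ⟨proj Φ x, (mem_subtorus_iff Φ).2 ⟨x, hx, rfl⟩, ?_⟩
    rw [mapMatrixHom_apply, mapMatrix_proj, Matrix.toLin'_apply]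
  · rintro ⟨s, hs, rfl⟩
    obtain ⟨x, hx, rfl⟩ := (mem_subtorus_iff Φ).1 hs
    refine ⟨Matrix.toLin' _ x, ⟨x, hx, rfl⟩, ?_⟩
    rw [mapMatrixHom_apply, mapMatrix_proj, Matrix.toLin'_apply]

/-- `A(Λ ∩ U) ⊆ Λ_Γ ∩ A_ℝ(U)`: lattice vectors of `Y` map to lattice vectors of `π(Y)`.
[cite: Lange2023AbelianVarietiesComplex, §1.1.2 ("a lattice containing `Λ`"), p. 21] -/
theorem quotientMatrix_mulVec_mem_subLattice_map {m : ι → ℤ} (hm : m ∈ subLattice U) :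
    (quotientMatrix Φ Γ) *ᵥ m ∈ subLattice (U.map (Matrix.toLin' ((quotientMatrix Φ Γ).map (Int.cast : ℤ → ℝ)))) := by
  rw [mem_subLattice_iff, ← intVec_mulVec]
  exact ⟨intVec m, hm, Matrix.toLin'_apply _ _⟩

/-- **If `Γ ∩ Y = 0` then `Λ_Γ ∩ A_ℝ(U) = A(Λ ∩ U)`**: every lattice vector of `π(Y) ⊂ X/Γ` comes from a lattice
vector of `Y` (a point of `π⁻¹(Γ) ∩ U` projects into `Γ ∩ Y = 0`, so lies in `Λ`) — `π|_Y : Y → π(Y)` is an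
isomorphism. [cite: Auffarth2016NonSimplePPAV, §3, proof of Lemma 3.7 ("`H ∩ {0} × Y = H ∩ X × {0} = {(0,0)}`")] [cite: Lange2023AbelianVarietiesComplex, §1.1.2 Prop. 1.1.13 (a), p. 21] -/
theorem exists_quotientMatrix_mulVec_eq_of_mem_subLattice_map (h : Γ ⊓ subtorus Φ U = ⊥) {m' : ι → ℤ}
    (hm' : m' ∈ subLattice (U.map (Matrix.toLin' ((quotientMatrix Φ Γ).map (Int.cast : ℤ → ℝ))))) :
    ∃ m ∈ subLattice U, (quotientMatrix Φ Γ) *ᵥ m = m' := by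
  rw [mem_subLattice_iff] at hm'
  obtain ⟨x, hx, hx'⟩ := hm'
  rw [Matrix.toLin'_apply] at hx'
  -- `π x ∈ Ker π = Γ` and `π x ∈ Y`
  have hker : proj Φ x ∈ (mapMatrixHom Φ (quotientByPeriod Φ Γ) (quotientMatrix Φ Γ)).ker :=
    (proj_mem_ker_mapMatrixHom_iff Φ _ _ x).2 ⟨m', hx'⟩
  rw [ker_mapMatrixHom_quotientBy] at hker
  have hY : proj Φ x ∈ subtorus Φ U := (mem_subtorus_iff Φ).2 ⟨x, hx, rfl⟩
  have h0 : proj Φ x = 0 := by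
    have := h ▸ AddSubgroup.mem_inf.2 ⟨hker, hY⟩
    rwa [AddSubgroup.mem_bot] at this
  obtain ⟨m, rfl⟩ := (proj_eq_zero_iff Φ).1 h0
  refine ⟨m, hx, ?_⟩
  have h1 : intVec ((quotientMatrix Φ Γ) *ᵥ m) = intVec m' := by rw [← intVec_mulVec, hx']
  funext i
  have := congrFun h1 i
  simpa [intVec] using this

/-- **`Λ ∩ U ≃ Λ_Γ ∩ A_ℝ(U)`, `m ↦ A m`** — the lattice of `Y` IS the lattice of `π(Y)` when `Γ ∩ Y = 0`.
[cite: Auffarth2016NonSimplePPAV, §3, proof of Lemma 3.7] [cite: IribarLopez2024NoetherLefschetzCycles, §2.2 Lemma 10 ("contains `(Y, θ_Y)`")] -/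
def subLatticeQuotientEquiv (h : Γ ⊓ subtorus Φ U = ⊥) :
    subLattice U ≃ₗ[ℤ] subLattice (U.map (Matrix.toLin' ((quotientMatrix Φ Γ).map (Int.cast : ℤ → ℝ)))) :=
  LinearEquiv.ofBijective
    ((Matrix.mulVecLin (quotientMatrix Φ Γ)).restrict fun m hm ↦ quotientMatrix_mulVec_mem_subLattice_map Φ Γ U hm)
    ⟨fun m n hmn ↦ Subtype.ext (by
        have h1 := congrArg (fun v : subLattice _ ↦ intVec (v : ι → ℤ)) hmn
        simp only [LinearMap.coe_restrict_apply, Matrix.mulVecLin_apply, ← intVec_mulVec] at h1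
        have h2 := mulVec_quotientMatrix_injective Φ Γ h1
        funext i
        have := congrFun h2 i
        simpa [intVec] using this),
      fun m' ↦ by
        obtain ⟨m, hm, hmm'⟩ := exists_quotientMatrix_mulVec_eq_of_mem_subLattice_map Φ Γ U h m'.2
        exact ⟨⟨m, hm⟩, Subtype.ext hmm'⟩⟩

/-- `subLatticeQuotientEquiv m = A m`. [cite: Auffarth2016NonSimplePPAV, §3, proof of Lemma 3.7] -/
@[simp] theorem coe_subLatticeQuotientEquiv (h : Γ ⊓ subtorus Φ U = ⊥) (m : subLattice U) :
    ((subLatticeQuotientEquiv Φ Γ U h m : subLattice _) : ι → ℤ) = (quotientMatrix Φ Γ) *ᵥ (m : ι → ℤ) := rfl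

end Descend

/-! ### §2 The type of the induced polarisation is an invariant of `(Λ_Y, E|Λ_Y)` -/

section TypeTransport

variable {ι ι' : Type*} {E E' : Type*} [NormedAddCommGroup E] [NormedSpace ℂ E] [NormedAddCommGroup E']
  [NormedSpace ℂ E'] {Φ : (ι → ℝ) ≃L[ℝ] E} {Φ' : (ι' → ℝ) ≃L[ℝ] E'} {η : E [⋀^Fin 2]→L[ℝ] ℝ}
  {η' : E' [⋀^Fin 2]→L[ℝ] ℝ} {V : Submodule ℝ (ι → ℝ)} {V' : Submodule ℝ (ι' → ℝ)}

/-- **The type of `ι_Y^*L` depends only on the isometry class of `(Λ_Y, E|_{Λ_Y})`**: a `ℤ`-linear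
isomorphism `e : Λ ∩ V ≃ Λ' ∩ V'` with `E'(e m, e m') = E(m, m')` transports symplectic bases, so `ι_{Y'}^*L'`
is of type `d` iff `ι_Y^*L` is ("the elementary divisors … are uniquely determined by `E` and `Λ`").
[cite: Lange2023AbelianVarietiesComplex, §1.5.1, p. 51] -/
theorem isSubPolarizationType_iff_of_subLatticeEquiv (e : subLattice V ≃ₗ[ℤ] subLattice V')
    (he : ∀ m m' : subLattice V, η' ![Φ' (intVec (e m : ι' → ℤ)), Φ' (intVec (e m' : ι' → ℤ))] =
      η ![Φ (intVec (m : ι → ℤ)), Φ (intVec (m' : ι → ℤ))]) {g : ℕ} (d : Fin g → ℕ) :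
    IsSubPolarizationType Φ' η' V' d ↔ IsSubPolarizationType Φ η V d := by
  constructor
  · rintro ⟨hc, b, huu, hvv, huv⟩
    have h1 : ∀ s, e (e.symm (b s)) = b s := fun s ↦ e.apply_symm_apply _
    refine ⟨hc, b.map e.symm, ?_, ?_, ?_⟩ <;> intro i j <;> simp only [Module.Basis.map_apply, ← he, h1]
    · exact huu i j
    · exact hvv i j
    · exact huv i j
  · rintro ⟨hc, b, huu, hvv, huv⟩
    refine ⟨hc, b.map e, ?_, ?_, ?_⟩ <;> intro i j <;> simp only [Module.Basis.map_apply, he]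
    · exact huu i j
    · exact hvv i j
    · exact huv i j

end TypeTransport

section DescendType

variable {ι : Type*} [Fintype ι] [DecidableEq ι] {E : Type*} [NormedAddCommGroup E] [NormedSpace ℂ E]
  (Φ : (ι → ℝ) ≃L[ℝ] E) (Γ : AddSubgroup (ComplexTorus Φ)) [Finite Γ] (η : E [⋀^Fin 2]→L[ℝ] ℝ)
  (U : Submodule ℝ (ι → ℝ))

/-- **The induced polarisation on `π(Y) ⊂ X/Γ` has the type of `ι_Y^*L` when `Γ ∩ Y = 0`** (for the descended
form `η` of `X/Γ`): `π|_Y : (Y, ι_Y^*L) ≅ (π(Y), ι_{π(Y)}^*M)` is an isomorphism of polarised tori.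
[cite: IribarLopez2024NoetherLefschetzCycles, §2.2 Lemma 10 ("contains `(Y, θ_Y)`, `(Z, θ_Z)`")] [cite: Lange2023AbelianVarietiesComplex, §1.5.1, p. 51] -/
theorem isSubPolarizationType_map_quotientMatrix_iff (h : Γ ⊓ subtorus Φ U = ⊥) {g : ℕ} (d : Fin g → ℕ) :
    IsSubPolarizationType (quotientByPeriod Φ Γ) η
        (U.map (Matrix.toLin' ((quotientMatrix Φ Γ).map (Int.cast : ℤ → ℝ)))) d ↔
      IsSubPolarizationType Φ η U d := by
  refine isSubPolarizationType_iff_of_subLatticeEquiv (subLatticeQuotientEquiv Φ Γ U h) (fun m m' ↦ ?_) d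
  rw [coe_subLatticeQuotientEquiv, coe_subLatticeQuotientEquiv, ← intVec_mulVec, ← intVec_mulVec,
    quotientPeriod_mulVec, quotientPeriod_mulVec]

end DescendType

/-! ### §3 The images `Y' = π(Y × 0)` and `Z' = π(0 × Z)` in Debarre's quotient `(Y × Z)/graph(p)` -/

section Debarre

variable {ι₁ ι₂ : Type*} [Fintype ι₁] [Fintype ι₂] [DecidableEq ι₁] [DecidableEq ι₂] {E₁ E₂ : Type*}
  [NormedAddCommGroup E₁] [NormedSpace ℂ E₁] [NormedAddCommGroup E₂] [NormedSpace ℂ E₂]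
  {Φ₁ : (ι₁ → ℝ) ≃L[ℝ] E₁} {Φ₂ : (ι₂ → ℝ) ≃L[ℝ] E₂} {ω₁ : E₁ [⋀^Fin 2]→L[ℝ] ℝ} {ω₂ : E₂ [⋀^Fin 2]→L[ℝ] ℝ}
  {K₁ : AddSubgroup (ComplexTorus Φ₁)} {K₂ : AddSubgroup (ComplexTorus Φ₂)} (p : K₁ →+ K₂)
  [Finite (graphSubgroup K₁ K₂ p)]

omit [DecidableEq ι₁] [DecidableEq ι₂] in
/-- `dim_ℝ (0 × X₂) = |ι₂|` in the lattice space of `X₁ × X₂` (companion of `finrank_fstSubspace`).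
[cite: Lange2023AbelianVarietiesComplex, §1.1.2 (the product `X × X'`), p. 21] -/
theorem finrank_sndSubspace :
    finrank ℝ (sndSubspace : Submodule ℝ (ι₁ ⊕ ι₂ → ℝ)) = Fintype.card ι₂ := by
  have h := LinearMap.finrank_range_add_finrank_ker (LinearMap.funLeft ℝ ℝ (Sum.inl : ι₁ → ι₁ ⊕ ι₂))
  rw [LinearMap.range_eq_top.2 (LinearMap.funLeft_surjective_of_injective _ _ _ Sum.inl_injective),
    finrank_top, Module.finrank_fintype_fun_eq_card, Module.finrank_fintype_fun_eq_card,
    Fintype.card_sum] at h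
  change _ + finrank ℝ (sndSubspace : Submodule ℝ (ι₁ ⊕ ι₂ → ℝ)) = _ at h
  omega

/-- **`Y' := π(Y × 0)` is a lattice subspace** of `(Y × Z)/graph(p)`.
[cite: IribarLopez2024NoetherLefschetzCycles, §2.2 Lemma 10 ("contains `(Y, θ_Y)`")] -/
theorem isLatticeSubspace_fstSubspace_map_graph :
    IsLatticeSubspace ((fstSubspace : Submodule ℝ (ι₁ ⊕ ι₂ → ℝ)).map (Matrix.toLin'
      ((quotientMatrix (prodPeriod Φ₁ Φ₂) (graphSubgroup K₁ K₂ p)).map (Int.cast : ℤ → ℝ)))) :=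
  isLatticeSubspace_map_quotientMatrix _ _ _ isLatticeSubspace_fstSubspace

/-- **`Z' := π(0 × Z)` is a lattice subspace** of `(Y × Z)/graph(p)`.
[cite: IribarLopez2024NoetherLefschetzCycles, §2.2 Lemma 10 ("contains `(Z, θ_Z)`")] -/
theorem isLatticeSubspace_sndSubspace_map_graph :
    IsLatticeSubspace ((sndSubspace : Submodule ℝ (ι₁ ⊕ ι₂ → ℝ)).map (Matrix.toLin'
      ((quotientMatrix (prodPeriod Φ₁ Φ₂) (graphSubgroup K₁ K₂ p)).map (Int.cast : ℤ → ℝ)))) :=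
  isLatticeSubspace_map_quotientMatrix _ _ _ isLatticeSubspace_sndSubspace

/-- **`Y'` is a complex sub-torus** (tangent space `E₁ × 0`). [cite: IribarLopez2024NoetherLefschetzCycles, §2.2 Lemma 10] -/
theorem isComplexSubspace_fstSubspace_map_graph :
    IsComplexSubspace (quotientByPeriod (prodPeriod Φ₁ Φ₂) (graphSubgroup K₁ K₂ p))
      ((fstSubspace : Submodule ℝ (ι₁ ⊕ ι₂ → ℝ)).map (Matrix.toLin'
        ((quotientMatrix (prodPeriod Φ₁ Φ₂) (graphSubgroup K₁ K₂ p)).map (Int.cast : ℤ → ℝ)))) :=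
  isComplexSubspace_map_quotientMatrix _ _ _ (isComplexSubspace_fstSubspace Φ₁ Φ₂)

/-- **`Z'` is a complex sub-torus** (tangent space `0 × E₂`). [cite: IribarLopez2024NoetherLefschetzCycles, §2.2 Lemma 10] -/
theorem isComplexSubspace_sndSubspace_map_graph :
    IsComplexSubspace (quotientByPeriod (prodPeriod Φ₁ Φ₂) (graphSubgroup K₁ K₂ p))
      ((sndSubspace : Submodule ℝ (ι₁ ⊕ ι₂ → ℝ)).map (Matrix.toLin'
        ((quotientMatrix (prodPeriod Φ₁ Φ₂) (graphSubgroup K₁ K₂ p)).map (Int.cast : ℤ → ℝ)))) :=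
  isComplexSubspace_map_quotientMatrix _ _ _ (isComplexSubspace_sndSubspace Φ₁ Φ₂)

/-- `dim Y' = dim Y` (`dim_ℝ = |ι₁|`). [cite: IribarLopez2024NoetherLefschetzCycles, §2.2 Lemma 10] -/
theorem finrank_fstSubspace_map_graph :
    finrank ℝ ((fstSubspace : Submodule ℝ (ι₁ ⊕ ι₂ → ℝ)).map (Matrix.toLin'
      ((quotientMatrix (prodPeriod Φ₁ Φ₂) (graphSubgroup K₁ K₂ p)).map (Int.cast : ℤ → ℝ)))) =
      Fintype.card ι₁ := by
  rw [finrank_map_quotientMatrix, finrank_fstSubspace]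

/-- `dim Z' = dim Z` (`dim_ℝ = |ι₂|`). [cite: IribarLopez2024NoetherLefschetzCycles, §2.2 Lemma 10] -/
theorem finrank_sndSubspace_map_graph :
    finrank ℝ ((sndSubspace : Submodule ℝ (ι₁ ⊕ ι₂ → ℝ)).map (Matrix.toLin'
      ((quotientMatrix (prodPeriod Φ₁ Φ₂) (graphSubgroup K₁ K₂ p)).map (Int.cast : ℤ → ℝ)))) =
      Fintype.card ι₂ := by
  rw [finrank_map_quotientMatrix, finrank_sndSubspace]

/-- **`Y' = π(Y × 0)`** as subgroups of `(Y × Z)/graph(p)` (on which `π` is injective for `p` injective,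
`eq_zero_of_mem_subtorus_fstSubspace_of_mapMatrix_quotientBy_eq_zero`). [cite: IribarLopez2024NoetherLefschetzCycles, §2.2 Lemma 10 ("contains `(Y, θ_Y)`")] -/
theorem subtorus_fstSubspace_map_graph :
    subtorus (quotientByPeriod (prodPeriod Φ₁ Φ₂) (graphSubgroup K₁ K₂ p))
        ((fstSubspace : Submodule ℝ (ι₁ ⊕ ι₂ → ℝ)).map (Matrix.toLin'
          ((quotientMatrix (prodPeriod Φ₁ Φ₂) (graphSubgroup K₁ K₂ p)).map (Int.cast : ℤ → ℝ)))) =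
      (subtorus (prodPeriod Φ₁ Φ₂) (fstSubspace : Submodule ℝ (ι₁ ⊕ ι₂ → ℝ))).map
        (mapMatrixHom (prodPeriod Φ₁ Φ₂) (quotientByPeriod (prodPeriod Φ₁ Φ₂) (graphSubgroup K₁ K₂ p))
          (quotientMatrix (prodPeriod Φ₁ Φ₂) (graphSubgroup K₁ K₂ p))) :=
  subtorus_map_quotientMatrix _ _ _

/-- **`Z' = π(0 × Z)`** as subgroups of `(Y × Z)/graph(p)`. [cite: IribarLopez2024NoetherLefschetzCycles, §2.2 Lemma 10 ("contains `(Z, θ_Z)`")] -/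
theorem subtorus_sndSubspace_map_graph :
    subtorus (quotientByPeriod (prodPeriod Φ₁ Φ₂) (graphSubgroup K₁ K₂ p))
        ((sndSubspace : Submodule ℝ (ι₁ ⊕ ι₂ → ℝ)).map (Matrix.toLin'
          ((quotientMatrix (prodPeriod Φ₁ Φ₂) (graphSubgroup K₁ K₂ p)).map (Int.cast : ℤ → ℝ)))) =
      (subtorus (prodPeriod Φ₁ Φ₂) (sndSubspace : Submodule ℝ (ι₁ ⊕ ι₂ → ℝ))).map
        (mapMatrixHom (prodPeriod Φ₁ Φ₂) (quotientByPeriod (prodPeriod Φ₁ Φ₂) (graphSubgroup K₁ K₂ p))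
          (quotientMatrix (prodPeriod Φ₁ Φ₂) (graphSubgroup K₁ K₂ p))) :=
  subtorus_map_quotientMatrix _ _ _

variable (ω₁ ω₂)

/-- **`(Y', ι_{Y'}^*θ_p)` has the type of `(Y, θ_Y)`**: for `p` injective the induced polarisation of
`p₁^*ω₁ + p₂^*ω₂` on `Y' = π(Y × 0)` is of type `d` iff `ω₁` is of type `d` ("contains `(Y, θ_Y)`").
[cite: IribarLopez2024NoetherLefschetzCycles, §2.2 Lemma 10] [cite: Lange2023AbelianVarietiesComplex, §1.5.1, p. 51] -/
theorem isSubPolarizationType_fstSubspace_map_graph_iff (hp : Injective p) {g : ℕ} (d : Fin g → ℕ) :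
    IsSubPolarizationType (quotientByPeriod (prodPeriod Φ₁ Φ₂) (graphSubgroup K₁ K₂ p)) (prodForm ω₁ ω₂)
        ((fstSubspace : Submodule ℝ (ι₁ ⊕ ι₂ → ℝ)).map (Matrix.toLin'
          ((quotientMatrix (prodPeriod Φ₁ Φ₂) (graphSubgroup K₁ K₂ p)).map (Int.cast : ℤ → ℝ)))) d ↔
      IsPolarizationType Φ₁ ω₁ d := by
  rw [isSubPolarizationType_map_quotientMatrix_iff _ _ _ _ (graphSubgroup_inf_subtorus_fstSubspace K₁ K₂ p hp),
    isSubPolarizationType_fstSubspace_iff]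

/-- **`(Z', ι_{Z'}^*θ_p)` has the type of `(Z, θ_Z)`**: the induced polarisation on `Z' = π(0 × Z)` is of
type `d` iff `ω₂` is of type `d` ("contains `(Z, θ_Z)`").
[cite: IribarLopez2024NoetherLefschetzCycles, §2.2 Lemma 10] [cite: Lange2023AbelianVarietiesComplex, §1.5.1, p. 51] -/
theorem isSubPolarizationType_sndSubspace_map_graph_iff {g : ℕ} (d : Fin g → ℕ) :
    IsSubPolarizationType (quotientByPeriod (prodPeriod Φ₁ Φ₂) (graphSubgroup K₁ K₂ p)) (prodForm ω₁ ω₂)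
        ((sndSubspace : Submodule ℝ (ι₁ ⊕ ι₂ → ℝ)).map (Matrix.toLin'
          ((quotientMatrix (prodPeriod Φ₁ Φ₂) (graphSubgroup K₁ K₂ p)).map (Int.cast : ℤ → ℝ)))) d ↔
      IsPolarizationType Φ₂ ω₂ d := by
  rw [isSubPolarizationType_map_quotientMatrix_iff _ _ _ _ (graphSubgroup_inf_subtorus_sndSubspace K₁ K₂ p),
    isSubPolarizationType_sndSubspace_iff]

/-- **`Y'` and `Z'` are COMPLEMENTARY: `(Y')^⊥ = Z'`** for `θ_p` (the descended `p₁^*ω₁ + p₂^*ω₂`), whenever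
`ω₁` is a Riemann form (`(Y × 0)^⊥ = 0 × Z` in the product, `orthSubspace_fstSubspace`).
[cite: IribarLopez2024NoetherLefschetzCycles, §2.2 Lemma 10 ("as complementary subvarieties")] [cite: Lange2023AbelianVarietiesComplex, §5.3.1, p. 262] -/
theorem orthSubspace_fstSubspace_map_graph (hω₁ : IsRiemannForm Φ₁ ω₁) :
    orthSubspace (quotientByPeriod (prodPeriod Φ₁ Φ₂) (graphSubgroup K₁ K₂ p)) (prodForm ω₁ ω₂)
        ((fstSubspace : Submodule ℝ (ι₁ ⊕ ι₂ → ℝ)).map (Matrix.toLin'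
          ((quotientMatrix (prodPeriod Φ₁ Φ₂) (graphSubgroup K₁ K₂ p)).map (Int.cast : ℤ → ℝ)))) =
      (sndSubspace : Submodule ℝ (ι₁ ⊕ ι₂ → ℝ)).map (Matrix.toLin'
        ((quotientMatrix (prodPeriod Φ₁ Φ₂) (graphSubgroup K₁ K₂ p)).map (Int.cast : ℤ → ℝ))) := by
  rw [orthSubspace_map_quotientMatrix, orthSubspace_fstSubspace Φ₁ Φ₂ ω₁ ω₂ hω₁]

omit [DecidableEq ι₁] [DecidableEq ι₂] in
/-- In the product `(X₁ × X₂, L₁ ⊠ L₂)`: **`(0 × X₂)^⊥ = X₁ × 0`** (from `orthSubspace_fstSubspace` and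
`(V^⊥)^⊥ = V`). [cite: Lange2023AbelianVarietiesComplex, §2.4.4 Cor. 2.4.24, p. 123] -/
theorem orthSubspace_sndSubspace (hω₁ : IsRiemannForm Φ₁ ω₁) (hω₂ : IsRiemannForm Φ₂ ω₂) :
    orthSubspace (prodPeriod Φ₁ Φ₂) (prodForm ω₁ ω₂) sndSubspace = fstSubspace := by
  rw [← orthSubspace_fstSubspace Φ₁ Φ₂ ω₁ ω₂ hω₁,
    orthSubspace_orthSubspace _ (hω₁.prod hω₂) (isComplexSubspace_fstSubspace Φ₁ Φ₂)]

/-- **`(Z')^⊥ = Y'`** (the pair `(Y', Z')` is complementary in both orders).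
[cite: IribarLopez2024NoetherLefschetzCycles, §2.2 Lemma 10 ("as complementary subvarieties")] [cite: Lange2023AbelianVarietiesComplex, §5.3.1, p. 262] -/
theorem orthSubspace_sndSubspace_map_graph (hω₁ : IsRiemannForm Φ₁ ω₁) (hω₂ : IsRiemannForm Φ₂ ω₂) :
    orthSubspace (quotientByPeriod (prodPeriod Φ₁ Φ₂) (graphSubgroup K₁ K₂ p)) (prodForm ω₁ ω₂)
        ((sndSubspace : Submodule ℝ (ι₁ ⊕ ι₂ → ℝ)).map (Matrix.toLin'
          ((quotientMatrix (prodPeriod Φ₁ Φ₂) (graphSubgroup K₁ K₂ p)).map (Int.cast : ℤ → ℝ)))) =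
      (fstSubspace : Submodule ℝ (ι₁ ⊕ ι₂ → ℝ)).map (Matrix.toLin'
        ((quotientMatrix (prodPeriod Φ₁ Φ₂) (graphSubgroup K₁ K₂ p)).map (Int.cast : ℤ → ℝ))) := by
  rw [orthSubspace_map_quotientMatrix, orthSubspace_sndSubspace ω₁ ω₂ hω₁ hω₂]

end Debarre

/-! ### §4 Iribar López 2024, Lemma 10, second assertion, assembled -/

section Main

variable {ι₁ ι₂ : Type*} [Fintype ι₁] [Fintype ι₂] [DecidableEq ι₁] [DecidableEq ι₂] {E₁ E₂ : Type*}
  [NormedAddCommGroup E₁] [NormedSpace ℂ E₁] [NormedAddCommGroup E₂] [NormedSpace ℂ E₂]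
  {Φ₁ : (ι₁ → ℝ) ≃L[ℝ] E₁} {Φ₂ : (ι₂ → ℝ) ≃L[ℝ] E₂} {ω₁ : E₁ [⋀^Fin 2]→L[ℝ] ℝ} {ω₂ : E₂ [⋀^Fin 2]→L[ℝ] ℝ}
  {G₁ : Matrix ι₁ ι₁ ℤ} {G₂ : Matrix ι₂ ι₂ ℤ}
  (hω₁ : IsRiemannForm Φ₁ ω₁) (hω₂ : IsRiemannForm Φ₂ ω₂)
  (hG₁ : G₁.map (Int.cast : ℤ → ℝ) = latticeGram Φ₁ ω₁) (hG₂ : G₂.map (Int.cast : ℤ → ℝ) = latticeGram Φ₂ ω₂)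
  {p : kerPhiH Φ₁ G₁ →+ kerPhiH Φ₂ G₂} (hp : Bijective p) (ha : IsAntisymplectic ω₁ ω₂ p)

include hω₁ hω₂ hG₁ hG₂ hp ha in
/-- **Iribar López 2024, Lemma 10 (Debarre's construction), the polarised torus and its complementary
pair.**  For polarised complex tori `(Y, ω₁)`, `(Z, ω₂)` (Riemann forms, `K(L₁) = kerPhiH Φ₁ G₁`,
`K(L₂) = kerPhiH Φ₂ G₂`) and an antisymplectic isomorphism `p : K(L₁) → K(L₂)`, let
`X_p = (Y × Z)/graph(p)` (`quotientByPeriod`), `θ_p` the descended `p₁^*ω₁ + p₂^*ω₂`, `A = ρ_r(π)` and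
`Y' = A_ℝ(Y × 0) = π(Y × 0)`, `Z' = A_ℝ(0 × Z) = π(0 × Z)`.  Then: `θ_p` is a PRINCIPAL polarisation; `Y'`,
`Z'` are abelian subvarieties (lattice subspaces, complex) of dimensions `dim Y`, `dim Z`; they are
COMPLEMENTARY (`(Y')^⊥ = Z'`, `(Z')^⊥ = Y'`); and the induced polarisations have exactly the types of
`(Y, ω₁)` and `(Z, ω₂)` — "`(Y × Z)/graph(p)` has a canonical principal polarization `θ_p` and contains
`(Y, θ_Y)`, `(Z, θ_Z)` as complementary subvarieties".  (Instance argument: `IsRiemannForm.finite_graphSubgroup`.)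
[cite: IribarLopez2024NoetherLefschetzCycles, §2.2 Lemma 10] [cite: Auffarth2016NonSimplePPAV, §3 (Debarre's morphism `Φ_{u,n−u}(D)`; proof of Lemma 3.7)] [cite: Debarre1988ThetaSingulierCodim3, (the original construction, via the two previous sources)] -/
theorem isPrincipalPolarization_and_complementary_pair_quotientBy_graphSubgroup
    [Finite (graphSubgroup (kerPhiH Φ₁ G₁) (kerPhiH Φ₂ G₂) p)] :
    IsPrincipalPolarization
        (quotientByPeriod (prodPeriod Φ₁ Φ₂) (graphSubgroup (kerPhiH Φ₁ G₁) (kerPhiH Φ₂ G₂) p))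
        (prodForm ω₁ ω₂) ∧
      IsLatticeSubspace ((fstSubspace : Submodule ℝ (ι₁ ⊕ ι₂ → ℝ)).map (Matrix.toLin'
        ((quotientMatrix (prodPeriod Φ₁ Φ₂) (graphSubgroup (kerPhiH Φ₁ G₁) (kerPhiH Φ₂ G₂) p)).map
          (Int.cast : ℤ → ℝ)))) ∧
      IsComplexSubspace (quotientByPeriod (prodPeriod Φ₁ Φ₂) (graphSubgroup (kerPhiH Φ₁ G₁) (kerPhiH Φ₂ G₂) p))
        ((fstSubspace : Submodule ℝ (ι₁ ⊕ ι₂ → ℝ)).map (Matrix.toLin'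
          ((quotientMatrix (prodPeriod Φ₁ Φ₂) (graphSubgroup (kerPhiH Φ₁ G₁) (kerPhiH Φ₂ G₂) p)).map
            (Int.cast : ℤ → ℝ)))) ∧
      IsLatticeSubspace ((sndSubspace : Submodule ℝ (ι₁ ⊕ ι₂ → ℝ)).map (Matrix.toLin'
        ((quotientMatrix (prodPeriod Φ₁ Φ₂) (graphSubgroup (kerPhiH Φ₁ G₁) (kerPhiH Φ₂ G₂) p)).map
          (Int.cast : ℤ → ℝ)))) ∧
      IsComplexSubspace (quotientByPeriod (prodPeriod Φ₁ Φ₂) (graphSubgroup (kerPhiH Φ₁ G₁) (kerPhiH Φ₂ G₂) p))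
        ((sndSubspace : Submodule ℝ (ι₁ ⊕ ι₂ → ℝ)).map (Matrix.toLin'
          ((quotientMatrix (prodPeriod Φ₁ Φ₂) (graphSubgroup (kerPhiH Φ₁ G₁) (kerPhiH Φ₂ G₂) p)).map
            (Int.cast : ℤ → ℝ)))) ∧
      orthSubspace (quotientByPeriod (prodPeriod Φ₁ Φ₂) (graphSubgroup (kerPhiH Φ₁ G₁) (kerPhiH Φ₂ G₂) p))
          (prodForm ω₁ ω₂)
          ((fstSubspace : Submodule ℝ (ι₁ ⊕ ι₂ → ℝ)).map (Matrix.toLin'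
            ((quotientMatrix (prodPeriod Φ₁ Φ₂) (graphSubgroup (kerPhiH Φ₁ G₁) (kerPhiH Φ₂ G₂) p)).map
              (Int.cast : ℤ → ℝ)))) =
        (sndSubspace : Submodule ℝ (ι₁ ⊕ ι₂ → ℝ)).map (Matrix.toLin'
          ((quotientMatrix (prodPeriod Φ₁ Φ₂) (graphSubgroup (kerPhiH Φ₁ G₁) (kerPhiH Φ₂ G₂) p)).map
            (Int.cast : ℤ → ℝ))) ∧
      (∀ (g : ℕ) (d : Fin g → ℕ),
        IsSubPolarizationType
            (quotientByPeriod (prodPeriod Φ₁ Φ₂) (graphSubgroup (kerPhiH Φ₁ G₁) (kerPhiH Φ₂ G₂) p))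
            (prodForm ω₁ ω₂)
            ((fstSubspace : Submodule ℝ (ι₁ ⊕ ι₂ → ℝ)).map (Matrix.toLin'
              ((quotientMatrix (prodPeriod Φ₁ Φ₂) (graphSubgroup (kerPhiH Φ₁ G₁) (kerPhiH Φ₂ G₂) p)).map
                (Int.cast : ℤ → ℝ)))) d ↔
          IsPolarizationType Φ₁ ω₁ d) ∧
      (∀ (g : ℕ) (d : Fin g → ℕ),
        IsSubPolarizationType
            (quotientByPeriod (prodPeriod Φ₁ Φ₂) (graphSubgroup (kerPhiH Φ₁ G₁) (kerPhiH Φ₂ G₂) p))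
            (prodForm ω₁ ω₂)
            ((sndSubspace : Submodule ℝ (ι₁ ⊕ ι₂ → ℝ)).map (Matrix.toLin'
              ((quotientMatrix (prodPeriod Φ₁ Φ₂) (graphSubgroup (kerPhiH Φ₁ G₁) (kerPhiH Φ₂ G₂) p)).map
                (Int.cast : ℤ → ℝ)))) d ↔
          IsPolarizationType Φ₂ ω₂ d) :=
  ⟨isPrincipalPolarization_quotientBy_graphSubgroup hω₁ hω₂ hG₁ hG₂ hp ha,
    isLatticeSubspace_fstSubspace_map_graph p, isComplexSubspace_fstSubspace_map_graph p,
    isLatticeSubspace_sndSubspace_map_graph p, isComplexSubspace_sndSubspace_map_graph p,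
    orthSubspace_fstSubspace_map_graph ω₁ ω₂ p hω₁,
    fun _ d ↦ isSubPolarizationType_fstSubspace_map_graph_iff ω₁ ω₂ p (ha.injective hG₁
      (hω₁.det_intGram_ne_zero hG₁) hG₂) d,
    fun _ d ↦ isSubPolarizationType_sndSubspace_map_graph_iff ω₁ ω₂ p d⟩

/-! ### §5 Consequence (Cor. 5.3.5): an antisymplectic `K(L₁) ≅ K(L₂)` forces complementary types -/

include hω₁ hω₂ hG₁ hG₂ hp ha in
/-- **The types of `(Y, ω₁)` and `(Z, ω₂)` are complementary: `δ̃ = (1, …, 1, δ)`.**  If `(Y, ω₁)` is of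
type `δ = (d₁, …, d_u)`, `(Z, ω₂)` of type `δ' = (d'₁, …, d'_v)` with `u ≤ v`, and there is an antisymplectic
isomorphism `K(L₁) ≅ K(L₂)`, then `d'_j = 1` for `j < v − u` and `d'_{v−u+i} = d_i` — Lange's Cor. 5.3.5 for the
complementary pair `(Y', Z')` of the principally polarised `(Y × Z)/graph(p)` ("if `θ|_Y` is of type
`(d₁, …, d_u)` then `θ|_Z` is of type `δ̃ = (1, …, 1, d₁, …, d_u)`").
[cite: IribarLopez2024NoetherLefschetzCycles, §2.2 (complementary type, "by [BL04]") and Lemma 10] [cite: Lange2023AbelianVarietiesComplex, §5.3.1 Cor. 5.3.5, p. 263] -/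
theorem IsAntisymplectic.polarizationType_eq_one_and_eq {u : ℕ} {δ : Fin u → ℕ} (hδ : IsPolarizationType Φ₁ ω₁ δ)
    {v : ℕ} {δ' : Fin v → ℕ} (hδ' : IsPolarizationType Φ₂ ω₂ δ') (huv : u ≤ v) :
    (∀ j : Fin v, (j : ℕ) < v - u → δ' j = 1) ∧ ∀ i : Fin u, δ' ⟨v - u + i, by omega⟩ = δ i := by
  haveI := hω₁.finite_graphSubgroup hG₁ p
  have hinj : Injective p := ha.injective hG₁ (hω₁.det_intGram_ne_zero hG₁) hG₂
  -- the complementary pair `(Y', Z')` of the principally polarised `(Y × Z)/graph(p)`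
  have hP := isPrincipalPolarization_quotientBy_graphSubgroup hω₁ hω₂ hG₁ hG₂ hp ha
  have hY := (isSubPolarizationType_fstSubspace_map_graph_iff ω₁ ω₂ p hinj δ).2 hδ
  have hZ := (isSubPolarizationType_sndSubspace_map_graph_iff ω₁ ω₂ p δ').2 hδ'
  rw [← orthSubspace_sndSubspace_map_graph ω₁ ω₂ p hω₁ hω₂] at hY
  have h2u := hY.two_mul_eq_finrank _ (isLatticeSubspace_orthSubspace _ hP.isRiemannForm
    (isLatticeSubspace_sndSubspace_map_graph p) (isComplexSubspace_sndSubspace_map_graph p))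
  have h2v := hZ.two_mul_eq_finrank _ (isLatticeSubspace_sndSubspace_map_graph p)
  obtain ⟨_, h1, h2⟩ := hP.isSubPolarizationType_compl _ (isLatticeSubspace_sndSubspace_map_graph p)
    (isComplexSubspace_sndSubspace_map_graph p) (by omega) hY hZ
  exact ⟨h1, h2⟩

include hω₁ hω₂ hG₁ hG₂ hp ha in
/-- In particular **`dim Y ≤ dim Z` forces `u ≤ v`-many … and `#`types agree on the tail**; the symmetric
reading (`v ≤ u`, using the antisymplectic inverse) gives `d_j = 1` for `j < u − v` and `d_{u−v+i} = d'_i`.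
[cite: IribarLopez2024NoetherLefschetzCycles, §2.2 and Lemma 10] [cite: Lange2023AbelianVarietiesComplex, §5.3.1 Cor. 5.3.5, p. 263] -/
theorem IsAntisymplectic.polarizationType_eq_one_and_eq' {u : ℕ} {δ : Fin u → ℕ} (hδ : IsPolarizationType Φ₁ ω₁ δ)
    {v : ℕ} {δ' : Fin v → ℕ} (hδ' : IsPolarizationType Φ₂ ω₂ δ') (hvu : v ≤ u) :
    (∀ j : Fin u, (j : ℕ) < u - v → δ j = 1) ∧ ∀ i : Fin v, δ ⟨u - v + i, by omega⟩ = δ' i := by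
  haveI := hω₁.finite_graphSubgroup hG₁ p
  have hinj : Injective p := ha.injective hG₁ (hω₁.det_intGram_ne_zero hG₁) hG₂
  have hP := isPrincipalPolarization_quotientBy_graphSubgroup hω₁ hω₂ hG₁ hG₂ hp ha
  have hY := (isSubPolarizationType_fstSubspace_map_graph_iff ω₁ ω₂ p hinj δ).2 hδ
  have hZ := (isSubPolarizationType_sndSubspace_map_graph_iff ω₁ ω₂ p δ').2 hδ'
  rw [← orthSubspace_fstSubspace_map_graph ω₁ ω₂ p hω₁] at hZ
  have h2v := hZ.two_mul_eq_finrank _ (isLatticeSubspace_orthSubspace _ hP.isRiemannForm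
    (isLatticeSubspace_fstSubspace_map_graph p) (isComplexSubspace_fstSubspace_map_graph p))
  have h2u := hY.two_mul_eq_finrank _ (isLatticeSubspace_fstSubspace_map_graph p)
  obtain ⟨_, h1, h2⟩ := hP.isSubPolarizationType_compl _ (isLatticeSubspace_fstSubspace_map_graph p)
    (isComplexSubspace_fstSubspace_map_graph p) (by omega) hZ hY
  exact ⟨h1, h2⟩

end Main


end ComplexTorus

end Literature.Geometry.Kaehler

end
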